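import Mathlib
import Summits.ValiantsHypothesis.ValiantsHypothesis.Theorems.BinomialElusiveBinomialCandidateInfinityStepTwoImproper
import Literature.RingTheory.MvPolynomial.RuppertReducibleProofs

/-!
# Crux `BinomialElusive.BinomialCandidate` (stmt-ValiantsHypothesis-7392), line `registered`,
# skeleton v7 — stub `stub_infinityIntegralRemainderOrders` (∞-IR): the orders of the affine
# `y₁`-coefficients along the integral remainder at the place over `x = ∞`

The registered stub `stub_infinityIntegralRemainderOrders` of the crux
`Summit.ValiantsHypothesis.ValiantsHypothesis.Theses.BinomialElusive.BinomialCandidate`.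

Data: a quadratic `Γ : ℂ^s → ℂ^m` (`totalDegree (Γ i) ≤ 2`), `N ≥ 1`, `a i < b i`, a formal Laurent
solution `p` of `Γ_i(p) = t^{-N a_i} + t^{-N b_i}` with least order `μ < 0`, pole direction
`z = (p_j.coeff μ)_j ≠ 0`, `B_i(z) = 0` for all `i` (`B_i = homogeneousComponent 2 (Γ i)`), and an
INTEGRAL remainder: every minor `z_k p_j - z_j p_k` has no coefficients at negative exponents.
Claim: there are affine polynomials `A_i` (`totalDegree ≤ 1`) whose linear parts annihilate `z`
and an arc `r` with `A_i(r) ≠ 0` of order exactly `-N b_i - μ`.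

Proof.  Take `A_i = Σ_j z_j ∂_jΓ_i` (the derivative along the pole direction), pick `j₀` with
`z_{j₀} ≠ 0`, normalise `Λ = z_{j₀}⁻¹ p_{j₀}` (no coefficients below `μ`, coefficient `1` at `μ`,
order `μ`) and put `r_j = p_j - z_j Λ = z_{j₀}⁻¹ (z_{j₀} p_j - z_j p_{j₀})`, an integral series by
the hypothesis on the minors.  The second-order Taylor formula for `Γ` of degree `≤ 2`
(`InfinityIntegralRemainder.taylor`, checked monomial by monomial),
`Γ(r + z Λ) = Γ(r) + Λ A(r) + Λ² B(z)`, together with `B_i(z) = 0`, gives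
`t^{-N a_i} + t^{-N b_i} = Γ_i(r) + Λ A_i(r)` with `Γ_i(r)` integral; so below `0` the series
`Λ A_i(r)` has the coefficients of the target: `0` below `-N b_i` and `1` at `-N b_i < 0`.  Hence
`Λ A_i(r) ≠ 0` has order `-N b_i`, `A_i(r) ≠ 0`, and `ord A_i(r) = -N b_i - μ`
(`HahnSeries.order_mul`).  Finally `deg A_i ≤ 1` (a derivative drops the degree), and
`Σ_k z_k coeff_{X_k} A_i = A_i(z) - A_i(0) = Σ_j z_j ∂_jB_i(z) = 2 B_i(z) = 0` by the formula for
the differential along the pole direction (`InfinityStepTwoImproper.sum_mul_eval_pderiv_eq`) and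
Euler's identity.

Mathlib only, plus the tree files imported above (`PolarPeeling.*`, `PolarImmersive.*`,
`AffinePeeling.*`, `InfinityCommonZero.*`, `InfinityStepTwoImproper.*`) and the Literature lemma
`Literature.RingTheory.MvPolynomial.Ruppert.totalDegree_pderiv_le`.
-/

-- layout Summits/ValiantsHypothesis/ValiantsHypothesis forces the duplicated namespace component
set_option linter.dupNamespace false

namespace Summit.ValiantsHypothesis.ValiantsHypothesis.Theorems.BinomialCandidateStubs

open scoped BigOperators

namespace InfinityIntegralRemainder

/-! ## The second-order Taylor formula for polynomials of degree `≤ 2` -/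

/-- An exponent vector of degree `≤ 2` is `0`, some `e_j`, or some `e_j + e_l` (`j = l` allowed). -/
theorem eq_of_degree_le_two {σ : Type*} (d : σ →₀ ℕ) (hd : d.degree ≤ 2) :
    d = 0 ∨ (∃ j, d = Finsupp.single j 1) ∨ ∃ j l, d = Finsupp.single j 1 + Finsupp.single l 1 := by
  classical
  rcases Nat.lt_or_ge d.degree 2 with h | h
  · rcases AffinePeeling.finsupp_eq_zero_or_single_of_degree_le_one d
        (show d.degree ≤ 1 by omega) with h0 | ⟨j, hj⟩
    · exact Or.inl h0
    · exact Or.inr (Or.inl ⟨j, hj⟩)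
  · have h2 : d.degree = 2 := le_antisymm hd h
    have hne : d ≠ 0 := by
      rintro rfl
      rw [map_zero] at h2
      exact absurd h2 (by decide)
    obtain ⟨j, hj⟩ := Finsupp.support_nonempty_iff.mpr hne
    have hj1 : Finsupp.single j 1 ≤ d :=
      Finsupp.single_le_iff.mpr (Nat.one_le_iff_ne_zero.mpr (Finsupp.mem_support_iff.mp hj))
    have hdd : d = (d - Finsupp.single j 1) + Finsupp.single j 1 := (tsub_add_cancel_of_le hj1).symm
    have hdeg : (d - Finsupp.single j 1).degree = 1 := by
      have h' := congrArg Finsupp.degree hdd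
      rw [map_add, Finsupp.degree_single, h2] at h'
      omega
    rcases AffinePeeling.finsupp_eq_zero_or_single_of_degree_le_one (d - Finsupp.single j 1)
        (show (d - Finsupp.single j 1).degree ≤ 1 by omega) with h0 | ⟨l, hl⟩
    · rw [h0, map_zero] at hdeg
      exact absurd hdeg (by decide)
    · exact Or.inr (Or.inr ⟨l, j, by rw [← hl]; exact hdd⟩)

variable {k : ℕ}

/-- The differential `D_w P = Σ_l w_l (∂_lP)(r)` kills constants. -/
theorem sum_mul_aeval_pderiv_C (r w : Fin k → LaurentSeries ℂ) (c : ℂ) :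
    ∑ l, w l * MvPolynomial.aeval r
      (MvPolynomial.pderiv l (MvPolynomial.C c : MvPolynomial (Fin k) ℂ)) = 0 := by
  simp only [MvPolynomial.pderiv_C, map_zero, mul_zero, Finset.sum_const_zero]

/-- The differential `D_w P = Σ_l w_l (∂_lP)(r)` on a variable: `D_w X_j = w_j`. -/
theorem sum_mul_aeval_pderiv_X (r w : Fin k → LaurentSeries ℂ) (j : Fin k) :
    ∑ l, w l * MvPolynomial.aeval r
      (MvPolynomial.pderiv l (MvPolynomial.X j : MvPolynomial (Fin k) ℂ)) = w j := by
  classical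
  rw [Finset.sum_eq_single j]
  · rw [MvPolynomial.pderiv_X_self, map_one, mul_one]
  · intro l _ hl
    rw [MvPolynomial.pderiv_X_of_ne (Ne.symm hl), map_zero, mul_zero]
  · intro h
    exact absurd (Finset.mem_univ j) h

/-- The differential `D_w P = Σ_l w_l (∂_lP)(r)` obeys the Leibniz rule. -/
theorem sum_mul_aeval_pderiv_mul (r w : Fin k → LaurentSeries ℂ) (P Q : MvPolynomial (Fin k) ℂ) :
    ∑ l, w l * MvPolynomial.aeval r (MvPolynomial.pderiv l (P * Q)) =
      (∑ l, w l * MvPolynomial.aeval r (MvPolynomial.pderiv l P)) * MvPolynomial.aeval r Q +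
        MvPolynomial.aeval r P * ∑ l, w l * MvPolynomial.aeval r (MvPolynomial.pderiv l Q) := by
  simp only [MvPolynomial.pderiv_mul, map_add, map_mul, Finset.sum_mul, Finset.mul_sum,
    ← Finset.sum_add_distrib]
  refine Finset.sum_congr rfl fun l _ => ?_
  ring

/-- **Taylor to second order, monomials.**  For a monomial `M = c y^d` of degree `≤ 2`:
`M(r + w) = M(r) + Σ_l w_l (∂_lM)(r) + M₂(w)`, `M₂` the degree-`2` homogeneous component. -/
theorem taylor_monomial (d : Fin k →₀ ℕ) (hd : d.degree ≤ 2) (c : ℂ)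
    (r w : Fin k → LaurentSeries ℂ) :
    MvPolynomial.aeval (fun j => r j + w j) (MvPolynomial.monomial d c) =
      MvPolynomial.aeval r (MvPolynomial.monomial d c) +
        ∑ l, w l * MvPolynomial.aeval r (MvPolynomial.pderiv l (MvPolynomial.monomial d c)) +
        MvPolynomial.aeval w (MvPolynomial.homogeneousComponent 2 (MvPolynomial.monomial d c)) := by
  classical
  have hc : MvPolynomial.homogeneousComponent 2 (MvPolynomial.monomial d c) =
      if 2 = d.degree then MvPolynomial.monomial d c else 0 :=
    MvPolynomial.homogeneousComponent_of_mem (MvPolynomial.isHomogeneous_monomial c rfl)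
  rcases eq_of_degree_le_two d hd with rfl | ⟨j, rfl⟩ | ⟨j, l, rfl⟩
  · rw [hc, if_neg (by simp), ← MvPolynomial.C_apply]
    simp only [MvPolynomial.aeval_C, sum_mul_aeval_pderiv_C, map_zero, add_zero]
  · rw [hc, if_neg (by simp), ← MvPolynomial.C_mul_X_eq_monomial]
    simp only [map_mul, MvPolynomial.aeval_C, MvPolynomial.aeval_X, sum_mul_aeval_pderiv_mul,
      sum_mul_aeval_pderiv_C, sum_mul_aeval_pderiv_X, map_zero]
    ring
  · rw [hc, if_pos (by simp), MvPolynomial.monomial_single_add, pow_one,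
      ← MvPolynomial.C_mul_X_eq_monomial]
    simp only [map_mul, MvPolynomial.aeval_C, MvPolynomial.aeval_X, sum_mul_aeval_pderiv_mul,
      sum_mul_aeval_pderiv_C, sum_mul_aeval_pderiv_X]
    ring

/-- **Taylor to second order** (polarisation).  For `Γ` of total degree `≤ 2` and points `r`, `w`
of a commutative `ℂ`-algebra (here `ℂ((t))`):
`Γ(r + w) = Γ(r) + Σ_l w_l (∂_lΓ)(r) + B(w)`, `B = homogeneousComponent 2 Γ`. -/
theorem polarization (Γ : MvPolynomial (Fin k) ℂ) (hΓ : Γ.totalDegree ≤ 2)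
    (r w : Fin k → LaurentSeries ℂ) :
    MvPolynomial.aeval (fun j => r j + w j) Γ =
      MvPolynomial.aeval r Γ + ∑ l, w l * MvPolynomial.aeval r (MvPolynomial.pderiv l Γ) +
        MvPolynomial.aeval w (MvPolynomial.homogeneousComponent 2 Γ) := by
  classical
  conv_lhs => rw [Γ.as_sum]
  conv_rhs => rw [Γ.as_sum]
  simp only [map_sum, Finset.mul_sum]
  rw [Finset.sum_comm, ← Finset.sum_add_distrib, ← Finset.sum_add_distrib]
  exact Finset.sum_congr rfl fun d hd =>
    taylor_monomial d (PolarPeeling.degree_le_of_mem_support hΓ hd) _ r w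

/-- Evaluation at constants: `P(z)` computed in `ℂ((t))` is the constant series `P(z)`. -/
theorem aeval_algebraMap_eq (z : Fin k → ℂ) (P : MvPolynomial (Fin k) ℂ) :
    MvPolynomial.aeval (fun j => algebraMap ℂ (LaurentSeries ℂ) (z j)) P =
      algebraMap ℂ (LaurentSeries ℂ) (MvPolynomial.eval z P) := by
  induction P using MvPolynomial.induction_on with
  | C a => rw [MvPolynomial.aeval_C, MvPolynomial.eval_C]
  | add p q hp hq => rw [map_add, map_add, hp, hq, map_add]
  | mul_X p j hp => rw [map_mul, map_mul, hp, MvPolynomial.aeval_X, MvPolynomial.eval_X, map_mul]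

/-- **Taylor along the pole direction.**  For `Γ` of total degree `≤ 2`, `z ∈ ℂ^k`, an arc `r` and
a series `Λ`: `Γ(r + Λ z) = Γ(r) + Λ (Σ_j z_j ∂_jΓ)(r) + Λ² B(z)`, `B = homogeneousComponent 2 Γ`. -/
theorem taylor (Γ : MvPolynomial (Fin k) ℂ) (hΓ : Γ.totalDegree ≤ 2) (z : Fin k → ℂ)
    (r : Fin k → LaurentSeries ℂ) (Λ : LaurentSeries ℂ) :
    MvPolynomial.aeval (fun j => r j + Λ * algebraMap ℂ (LaurentSeries ℂ) (z j)) Γ =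
      MvPolynomial.aeval r Γ + Λ * MvPolynomial.aeval r (∑ j, z j • MvPolynomial.pderiv j Γ) +
        Λ * Λ * algebraMap ℂ (LaurentSeries ℂ)
          (MvPolynomial.eval z (MvPolynomial.homogeneousComponent 2 Γ)) := by
  rw [polarization Γ hΓ r (fun j => Λ * algebraMap ℂ (LaurentSeries ℂ) (z j))]
  have e1 : MvPolynomial.aeval (fun j => Λ * algebraMap ℂ (LaurentSeries ℂ) (z j))
      (MvPolynomial.homogeneousComponent 2 Γ) =
      Λ ^ 2 * MvPolynomial.aeval (fun j => algebraMap ℂ (LaurentSeries ℂ) (z j))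
        (MvPolynomial.homogeneousComponent 2 Γ) :=
    PolarImmersive.aeval_mul_of_isHomogeneous _
      (MvPolynomial.homogeneousComponent_isHomogeneous 2 Γ) Λ _
  have e2 := aeval_algebraMap_eq z (MvPolynomial.homogeneousComponent 2 Γ)
  have e3 : MvPolynomial.aeval r (∑ j, z j • MvPolynomial.pderiv j Γ) =
      ∑ j, algebraMap ℂ (LaurentSeries ℂ) (z j) * MvPolynomial.aeval r (MvPolynomial.pderiv j Γ) := by
    rw [map_sum]
    refine Finset.sum_congr rfl fun j _ => ?_
    rw [MvPolynomial.smul_eq_C_mul, map_mul, MvPolynomial.aeval_C]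
  rw [e1, e2, e3, Finset.mul_sum]
  congr 2
  · refine Finset.sum_congr rfl fun j _ => ?_
    ring
  · ring

/-! ## The derivative along the pole direction: degree and linear part -/

/-- `A = Σ_j z_j ∂_jΓ` has total degree `≤ 1` for `Γ` of total degree `≤ 2`. -/
theorem totalDegree_dirDeriv_le (Γ : MvPolynomial (Fin k) ℂ) (hΓ : Γ.totalDegree ≤ 2)
    (z : Fin k → ℂ) : (∑ j, z j • MvPolynomial.pderiv j Γ).totalDegree ≤ 1 :=
  MvPolynomial.totalDegree_finsetSum_le fun j _ =>
    (MvPolynomial.totalDegree_smul_le _ _).trans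
      ((Literature.RingTheory.MvPolynomial.Ruppert.totalDegree_pderiv_le j Γ).trans (by omega))

/-- The linear part of an affine polynomial paired with `z`: `Σ_l z_l coeff_{X_l} Q = Q(z) - Q(0)`. -/
theorem sum_mul_coeff_single_eq (Q : MvPolynomial (Fin k) ℂ) (hQ : Q.totalDegree ≤ 1)
    (z : Fin k → ℂ) :
    ∑ l, z l * MvPolynomial.coeff (Finsupp.single l 1) Q =
      MvPolynomial.eval z Q - MvPolynomial.eval 0 Q := by
  classical
  have h : ∀ u : Fin k → ℂ, MvPolynomial.eval u Q =
      MvPolynomial.coeff 0 Q + ∑ j, MvPolynomial.coeff (Finsupp.single j 1) Q * u j := fun u => by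
    conv_lhs => rw [AffinePeeling.eq_affine_of_totalDegree_le_one Q hQ]
    simp only [map_add, map_sum, map_mul, MvPolynomial.eval_C, MvPolynomial.eval_X]
  rw [h z, h 0]
  simp only [Pi.zero_apply, mul_zero, Finset.sum_const_zero, add_zero, add_sub_cancel_left]
  exact Finset.sum_congr rfl fun l _ => mul_comm _ _

/-- **The linear part of `A = Σ_j z_j ∂_jΓ` annihilates `z` up to `2 B(z)`:**
`Σ_l z_l coeff_{X_l} A = A(z) - A(0) = Σ_j z_j (∂_jB)(z) = 2 B(z)` (`B = homogeneousComponent 2 Γ`;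
the differential along the pole direction, then Euler's identity). -/
theorem sum_mul_coeff_dirDeriv (Γ : MvPolynomial (Fin k) ℂ) (hΓ : Γ.totalDegree ≤ 2)
    (z : Fin k → ℂ) :
    ∑ l, z l * MvPolynomial.coeff (Finsupp.single l 1) (∑ j, z j • MvPolynomial.pderiv j Γ) =
      2 * MvPolynomial.eval z (MvPolynomial.homogeneousComponent 2 Γ) := by
  classical
  rw [sum_mul_coeff_single_eq _ (totalDegree_dirDeriv_le Γ hΓ z) z]
  have he : ∀ u : Fin k → ℂ, MvPolynomial.eval u (∑ j, z j • MvPolynomial.pderiv j Γ) =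
      ∑ j, z j * MvPolynomial.eval u (MvPolynomial.pderiv j Γ) := fun u => by
    rw [map_sum]
    exact Finset.sum_congr rfl fun j _ => MvPolynomial.smul_eval _ _ _
  rw [he, he, InfinityStepTwoImproper.sum_mul_eval_pderiv_eq Γ hΓ z z,
    InfinityStepTwoImproper.sum_mul_eval_pderiv_eq Γ hΓ z 0]
  simp only [Pi.zero_apply, zero_mul, Finset.sum_const_zero, add_zero, add_sub_cancel_left]
  have h := congrArg (MvPolynomial.eval z)
    (MvPolynomial.homogeneousComponent_isHomogeneous 2 Γ).sum_X_mul_pderiv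
  rw [map_sum, map_nsmul] at h
  simp only [map_mul, MvPolynomial.eval_X] at h
  rw [h, nsmul_eq_mul, Nat.cast_ofNat]

end InfinityIntegralRemainder

open InfinityIntegralRemainder in
/-- **Stub `stub_infinityIntegralRemainderOrders` (∞-IR)** (crux stmt-ValiantsHypothesis-7392, line
`registered`, skeleton v7).  Let `p` be a formal Laurent solution of
`Γ_i(p) = t^{-N a_i} + t^{-N b_i}` (`Γ` quadratic, `N ≥ 1`, `a_i < b_i`) with least order `μ < 0`,
pole direction `z = (p_j.coeff μ)_j ≠ 0`, `B_i(z) = 0` for all `i`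
(`B_i = homogeneousComponent 2 (Γ i)`), and integral minors `z_k p_j - z_j p_k` (no coefficients
at negative exponents).  Then there are `A_i` of total degree `≤ 1` with
`Σ_k z_k coeff_{X_k} A_i = 0` and an arc `r` with `A_i(r) ≠ 0` of order `-N b_i - μ` — namely
`A_i = Σ_j z_j ∂_jΓ_i` and `r_j = p_j - z_j Λ`, `Λ = z_{j₀}⁻¹ p_{j₀}` for any `z_{j₀} ≠ 0`. -/
theorem stub_infinityIntegralRemainderOrders :
    ∀ (m s : ℕ) (a b : Fin m → ℕ) (Γ : Fin m → MvPolynomial (Fin s) ℂ) (N : ℕ) (p : Fin s → LaurentSeries ℂ) (μ : ℤ),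
      (∀ i, (Γ i).totalDegree ≤ 2) → 0 < N → (∀ i, a i < b i) →
      (∀ i, MvPolynomial.aeval p (Γ i) =
        HahnSeries.single (-((N * a i : ℕ) : ℤ)) (1 : ℂ) + HahnSeries.single (-((N * b i : ℕ) : ℤ)) (1 : ℂ)) →
      μ < 0 → (∀ j, ∀ g < μ, (p j).coeff g = 0) → (fun j => (p j).coeff μ) ≠ 0 →
      (∀ i, MvPolynomial.eval (fun j => (p j).coeff μ) (MvPolynomial.homogeneousComponent 2 (Γ i)) = 0) →
      (∀ j k, ∀ g < 0, ((p k).coeff μ • p j - (p j).coeff μ • p k).coeff g = 0) →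
      ∃ (A : Fin m → MvPolynomial (Fin s) ℂ) (r : Fin s → LaurentSeries ℂ),
        (∀ i, (A i).totalDegree ≤ 1) ∧
        (∀ i, ∑ k, (p k).coeff μ * MvPolynomial.coeff (Finsupp.single k 1) (A i) = 0) ∧
        (∀ i, MvPolynomial.aeval r (A i) ≠ 0) ∧
        (∀ i, (MvPolynomial.aeval r (A i)).order = -((N * b i : ℕ) : ℤ) - μ) := by
  intro m s a b Γ N p μ hΓ hN hab hsol _hμ hp hz hBz hmin
  classical
  -- the exponents of the target: `-N b_i < -N a_i` and `-N b_i < 0`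
  have huv : ∀ i, -((N * b i : ℕ) : ℤ) < -((N * a i : ℕ) : ℤ) := fun i =>
    neg_lt_neg (by exact_mod_cast Nat.mul_lt_mul_of_pos_left (hab i) hN)
  have hv0 : ∀ i, -((N * b i : ℕ) : ℤ) < 0 := fun i =>
    neg_lt_zero.mpr (by exact_mod_cast Nat.mul_pos hN (Nat.zero_lt_of_lt (hab i)))
  -- the pole direction `z` and a coordinate `j₀` with `z j₀ ≠ 0`
  set z : Fin s → ℂ := fun j => (p j).coeff μ with hzdef
  obtain ⟨j₀, hj₀⟩ : ∃ j₀, z j₀ ≠ 0 := Function.ne_iff.mp hz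
  -- `Λ = z_{j₀}⁻¹ p_{j₀}`: no coefficients below `μ`, coefficient `1` at `μ`, order `μ`
  -- (adapted from the tree proof of `stub_infinityStepTwoImproper`)
  set Λ : LaurentSeries ℂ := (z j₀)⁻¹ • p j₀ with hΛdef
  have hΛcoeff : ∀ g, Λ.coeff g = (z j₀)⁻¹ * (p j₀).coeff g := fun g => by
    rw [hΛdef, HahnSeries.coeff_smul, smul_eq_mul]
  have hΛvan : ∀ g < μ, Λ.coeff g = 0 := fun g hg => by
    rw [hΛcoeff, hp j₀ g hg, mul_zero]
  have hΛμ : Λ.coeff μ = 1 := by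
    rw [hΛcoeff]
    exact inv_mul_cancel₀ hj₀
  have hΛne : Λ ≠ 0 := by
    intro h
    have h1 := hΛμ
    rw [h, HahnSeries.coeff_zero] at h1
    exact zero_ne_one h1
  have hΛord : Λ.order = μ := by
    refine le_antisymm (HahnSeries.order_le_of_coeff_ne_zero (by rw [hΛμ]; exact one_ne_zero)) ?_
    by_contra h
    exact (HahnSeries.coeff_order_eq_zero.not.mpr hΛne) (hΛvan _ (not_le.mp h))
  -- the integral remainder `r j = p j - z j Λ = z_{j₀}⁻¹ (z_{j₀} p_j - z_j p_{j₀})`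
  set r : Fin s → LaurentSeries ℂ := fun j => p j - z j • Λ with hrdef
  have hr : ∀ j, ∀ g < 0, (r j).coeff g = 0 := by
    intro j g hg
    have h : z j₀ * (p j).coeff g - z j * (p j₀).coeff g = 0 := by
      simpa only [HahnSeries.coeff_sub, HahnSeries.coeff_smul, smul_eq_mul] using hmin j j₀ g hg
    have hinv : (z j₀)⁻¹ * z j₀ = 1 := inv_mul_cancel₀ hj₀
    simp only [hrdef, HahnSeries.coeff_sub, HahnSeries.coeff_smul, smul_eq_mul, hΛcoeff]
    linear_combination (z j₀)⁻¹ * h - (p j).coeff g * hinv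
  have halg : ∀ c : ℂ, algebraMap ℂ (LaurentSeries ℂ) c = HahnSeries.C c := fun c => by
    rw [AffinePeeling.algebraMap_laurentSeries_apply, HahnSeries.C_apply]
  have hpr : p = fun j => r j + Λ * algebraMap ℂ (LaurentSeries ℂ) (z j) := by
    funext j
    rw [halg, mul_comm, HahnSeries.C_mul_eq_smul]
    simp only [hrdef, sub_add_cancel]
  -- the affine polynomials `A i = Σ_j z_j ∂_jΓ_i`
  set A : Fin m → MvPolynomial (Fin s) ℂ := fun i => ∑ j, z j • MvPolynomial.pderiv j (Γ i)
    with hAdef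
  have hAdeg : ∀ i, (A i).totalDegree ≤ 1 := fun i => totalDegree_dirDeriv_le (Γ i) (hΓ i) z
  have hAz : ∀ i, ∑ k, z k * MvPolynomial.coeff (Finsupp.single k 1) (A i) = 0 := fun i => by
    have h := sum_mul_coeff_dirDeriv (Γ i) (hΓ i) z
    rw [hBz i, mul_zero] at h
    exact h
  -- below `0`, `Λ A_i(r)` has the coefficients of the target
  have htarget : ∀ i, ∀ g < 0, (Λ * MvPolynomial.aeval r (A i)).coeff g =
      (HahnSeries.single (-((N * a i : ℕ) : ℤ)) (1 : ℂ) +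
        HahnSeries.single (-((N * b i : ℕ) : ℤ)) (1 : ℂ)).coeff g := by
    intro i g hg
    rw [← hsol i, hpr, taylor (Γ i) (hΓ i) z r Λ, hBz i, map_zero, mul_zero, add_zero,
      HahnSeries.coeff_add,
      InfinityCommonZero.coeff_aeval_eq_zero_of_lt_two_mul (Γ i) (hΓ i) r 0 le_rfl hr g (by omega),
      zero_add]
  have hlead : ∀ i, (Λ * MvPolynomial.aeval r (A i)).coeff (-((N * b i : ℕ) : ℤ)) = 1 := fun i => by
    rw [htarget i _ (hv0 i), InfinityCommonZero.coeff_single_add_single_right (huv i)]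
  have hbelow : ∀ i, ∀ g < -((N * b i : ℕ) : ℤ), (Λ * MvPolynomial.aeval r (A i)).coeff g = 0 :=
    fun i g hg => by
      rw [htarget i g (hg.trans (hv0 i)),
        InfinityCommonZero.coeff_single_add_single_of_ne (hg.trans (huv i)).ne hg.ne]
  have hAne : ∀ i, MvPolynomial.aeval r (A i) ≠ 0 := fun i h => by
    have h1 := hlead i
    rw [h, mul_zero, HahnSeries.coeff_zero] at h1
    exact zero_ne_one h1
  have hXord : ∀ i, (Λ * MvPolynomial.aeval r (A i)).order = -((N * b i : ℕ) : ℤ) := fun i => by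
    refine le_antisymm (HahnSeries.order_le_of_coeff_ne_zero (by rw [hlead i]; exact one_ne_zero)) ?_
    by_contra h
    exact (HahnSeries.coeff_order_eq_zero.not.mpr (mul_ne_zero hΛne (hAne i)))
      (hbelow i _ (not_le.mp h))
  refine ⟨A, r, hAdeg, hAz, hAne, fun i => ?_⟩
  have h := HahnSeries.order_mul hΛne (hAne i)
  rw [hXord i, hΛord] at h
  linarith

end Summit.ValiantsHypothesis.ValiantsHypothesis.Theorems.BinomialCandidateStubs
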